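/-
HONEST FRAMING: certified error envelopes and provably optimal rounding/accumulation schemes for
low-precision formats under stated cost models; every table by two implementations; no hardware
or vendor claims.
-/
import Summits.Ventures.CertifiedArithmetic.LowPrec.OptDemotionRoutingCone
import Summits.Ventures.CertifiedArithmetic.LowPrec.OptDemotionRoutingTT

/-!
# The demotion law (Theorem T8), part 9c: the routing table of a tree and the cone-closure principle

The tree side of the cone-closure certificates (part 9b): the TABLE of a summation tree,
`tab q t i = BR_t(bits(2^(q-1) + i))` — the bit-routing value (part 8d) on the `2^(q-1)` mantissas
of the top binade in budget units — and the three bridges that make part 9b's abstract node map THE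
node rule of `BR` (part 8a):
* PART BRIDGE `treeBR_eq_of_val_eq_pval`: a child configuration whose value is that of the part
  descriptor `some (i, L)` (`2^L (2^(q-1) + i) / 2^q`) scores `2^L · tab_i / 2^q` (uniqueness of
  binary expansions, part 8i′, and homogeneity `BR(2c) = 2 BR(c)`, part 8j); the empty part scores `0`;
* NODE BRIDGE `tab_node`: if the SPLIT DATA of mantissa `i` lists exactly the value pairs of the
  valid splits (`coordValid`, a decidable statement about part 8a's `splits`, checked by
  `decide +kernel` per `q` in parts 9e ff.), then `tab (a·b) i = 2^(q-1) + Ĥ_i(tab a, tab b) / 2^q`;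
* VALUE BRIDGE `treeBRv_pval`: `BR_t` by value (part 8l) at `2^L (2^(q-1) + i) / 2^q` is
  `2^L · tab_i / 2^q`.
Hence THE CONE-CLOSURE PRINCIPLE `tab_inCone`: valid split data + a passing certificate tree for
every row ⟹ the table of EVERY tree lies in the cone of the rows (tree induction with part 9b's
`inCone_nodeMap`).  Part 9d turns the `O`/`E` rows of the cone into `TT q`.
-/

namespace Summit.Ventures.CertifiedArithmetic.LowPrec.Opt

open Literature.ComputerArithmetic.JeannerodRump2018
open Literature.ComputerArithmetic.JeannerodRump2018.SumTree
open Cone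

/-! ## The table of a tree and the value of a part -/

/-- THE TABLE of a tree: `tab q t i = BR_t(bits(2^(q-1) + i))`, the routing value on mantissa
`2^(q-1) + i` of the top binade `[2^(q-1), 2^q)` (budget units). -/
def tab (q : ℕ) (t : SumTree) (i : ℕ) : ℚ := treeBR q t (natBits (2 ^ (q - 1) + i))

/-- Tables are nonnegative. -/
theorem tab_nonneg (q : ℕ) (t : SumTree) (i : ℕ) : 0 ≤ tab q t i := treeBR_nonneg q t _

/-- A leaf's table is `0`. -/
theorem tab_leaf (q : ℕ) (x : ℚ) (i : ℕ) : tab q (.leaf x) i = 0 := by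
  simp [tab, treeBR]

/-- THE VALUE of a part descriptor (budget units): `0` for the empty part,
`2^L (2^(q-1) + i) / 2^q` for `some (i, L)`. -/
def pval (q : ℕ) : Part → ℚ
  | none => 0
  | some (i, L) => 2 ^ L * ((2 ^ (q - 1) + i : ℕ) : ℚ) / 2 ^ q

/-- The configuration of the part `some (i, L)`: the bits of `2^(q-1) + i` shifted by `L - q`. -/
theorem val_shift_natBits (q i L : ℕ) :
    val ((natBits (2 ^ (q - 1) + i)).image fun e => e + ((L : ℤ) - q)) = pval q (some (i, L)) := by
  rw [val_image_add, val_natBits, pval, zpow_sub₀ (by norm_num : (2 : ℚ) ≠ 0), zpow_natCast,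
    zpow_natCast]
  ring

/-- … and its routing value: `2^L · tab_i / 2^q`. -/
theorem treeBR_shift_natBits (q : ℕ) (t : SumTree) (i L : ℕ) :
    treeBR q t ((natBits (2 ^ (q - 1) + i)).image fun e => e + ((L : ℤ) - q)) =
      2 ^ L * tab q t i / 2 ^ q := by
  rw [treeBR, treeBRw_zpow_shift, tab, treeBR, zpow_sub₀ (by norm_num : (2 : ℚ) ≠ 0), zpow_natCast,
    zpow_natCast]
  ring

/-- **PART BRIDGE.** A configuration with the value of a part descriptor scores that part's reading
of the table (`2^q`-scaled units of part 9b). -/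
theorem treeBR_eq_of_val_eq_pval {q : ℕ} (t : SumTree) {A : Finset ℤ} {p : Part}
    (h : val A = pval q p) : treeBR q t A = partEval p (tab q t) / 2 ^ q := by
  rcases p with _ | ⟨i, L⟩
  · have hA : A = ∅ := eq_of_val_eq A ∅ (by rw [h, val_empty]; rfl)
    rw [hA, treeBR, treeBRw_empty]
    simp [partEval]
  · have hA : A = (natBits (2 ^ (q - 1) + i)).image fun e => e + ((L : ℤ) - q) :=
      eq_of_val_eq _ _ (by rw [h, val_shift_natBits])
    rw [hA, treeBR_shift_natBits]
    simp [partEval]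

/-- **VALUE BRIDGE.** `BR_t` by value at a part's value. -/
theorem treeBRv_pval (q : ℕ) (t : SumTree) (i L : ℕ) :
    treeBRv q t (pval q (some (i, L))) = 2 ^ L * tab q t i / 2 ^ q := by
  rw [← val_shift_natBits, treeBRv_val, treeBR_shift_natBits]

/-! ## Split data and the node bridge -/

/-- VALIDITY OF SPLIT DATA at mantissa `i`: the listed pairs of part descriptors have exactly the
value pairs of the valid splits (part 8a `splits`) of `bits(2^(q-1) + i)` with the injected half
ulp at exponent `-1`.  Decidable; checked by `decide +kernel` per `q`. -/
def coordValid (q : ℕ) (d : List (Part × Part)) (i : ℕ) : Bool :=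
  decide (((splits q (natBits (2 ^ (q - 1) + i)) ((q : ℤ) - 1)).image
      fun AB => (val AB.1, val AB.2)) =
    (d.map fun s => (pval q s.1, pval q s.2)).toFinset)

/-- Validity of split data for every mantissa of the top binade. -/
def dataValid (q : ℕ) (data : List (List (Part × Part))) : Bool :=
  (List.range (2 ^ (q - 1))).all fun i => coordValid q (data.getD i []) i

/-- **NODE BRIDGE.** With valid split data, the table of a node is part 9b's abstract node map of
the children's tables: `tab (a·b) i = 2^(q-1) + Ĥ_i(tab a, tab b) / 2^q`. -/
theorem tab_node {q : ℕ} (hq : 1 ≤ q) {i : ℕ} (hi : i < 2 ^ (q - 1)) {d : List (Part × Part)}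
    (hd : coordValid q d i = true) (a b : SumTree) :
    tab q (.node a b) i = 2 ^ (q - 1) + hHat d (tab q a) (tab q b) / 2 ^ q := by
  simp only [coordValid, decide_eq_true_eq] at hd
  have hm : 2 ^ (q - 1) ≤ 2 ^ (q - 1) + i := Nat.le_add_right _ _
  have hm' : 2 ^ (q - 1) + i < 2 ^ q := by
    have : 2 ^ q = 2 ^ (q - 1) * 2 := by rw [← pow_succ]; congr 1; omega
    omega
  have hne : (natBits (2 ^ (q - 1) + i)).Nonempty := ⟨_, pred_mem_natBits hq hm hm'⟩
  have hmax : (natBits (2 ^ (q - 1) + i)).max' hne = (q : ℤ) - 1 := natBits_max' hq hm hm' hne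
  have hW : (2 : ℚ) ^ ((q : ℤ) - 1) = 2 ^ (q - 1) := by
    rw [show ((q : ℤ) - 1) = ((q - 1 : ℕ) : ℤ) by omega, zpow_natCast]
  have h2q : (0 : ℚ) < 2 ^ q := by positivity
  rw [tab, treeBR, treeBRw_node q _ a b hne, hmax, hW, add_right_inj]
  apply le_antisymm
  · refine (Finset.fold_max_le _).2 ⟨div_nonneg (hHat_nonneg _ _ _) h2q.le, fun AB hAB => ?_⟩
    have hmem : (val AB.1, val AB.2) ∈ (d.map fun s => (pval q s.1, pval q s.2)).toFinset := by
      rw [← hd]; exact Finset.mem_image_of_mem _ hAB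
    obtain ⟨s, hs, hsv⟩ := List.mem_map.1 (List.mem_toFinset.1 hmem)
    obtain ⟨h1, h2⟩ := Prod.mk.inj hsv
    change treeBR q a AB.1 + treeBR q b AB.2 ≤ _
    rw [treeBR_eq_of_val_eq_pval a h1.symm, treeBR_eq_of_val_eq_pval b h2.symm, ← add_div]
    exact div_le_div_of_nonneg_right (splitEval_le_hHat hs _ _) h2q.le
  · rw [div_le_iff₀ h2q]
    refine foldMax_le (mul_nonneg (fold_max_nonneg _ _) h2q.le) fun x hx => ?_
    obtain ⟨s, hs, rfl⟩ := List.mem_map.1 hx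
    have hmem : (pval q s.1, pval q s.2) ∈
        (splits q (natBits (2 ^ (q - 1) + i)) ((q : ℤ) - 1)).image
          fun AB => (val AB.1, val AB.2) := by
      rw [hd]; exact List.mem_toFinset.2 (List.mem_map.2 ⟨s, hs, rfl⟩)
    obtain ⟨AB, hAB, hv⟩ := Finset.mem_image.1 hmem
    obtain ⟨h1, h2⟩ := Prod.mk.inj hv
    have hle : treeBR q a AB.1 + treeBR q b AB.2 ≤
        (splits q (natBits (2 ^ (q - 1) + i)) ((q : ℤ) - 1)).fold max 0
          (fun AB => treeBRw q (fun e => (2 : ℚ) ^ e) a AB.1 +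
            treeBRw q (fun e => (2 : ℚ) ^ e) b AB.2) :=
      (Finset.le_fold_max _).2 (Or.inr ⟨AB, hAB, le_rfl⟩)
    rw [treeBR_eq_of_val_eq_pval a h1, treeBR_eq_of_val_eq_pval b h2, ← add_div,
      div_le_iff₀ h2q] at hle
    exact hle

/-! ## The cone-closure principle -/

/-- **THE CONE-CLOSURE PRINCIPLE.** If the split data is valid (`dataValid`, by `decide`) and every
row of `rows` has a passing certificate tree (`rowCheck`, by `decide`), then the table of EVERY
summation tree lies in the cone `{v ≥ 0 : dot r v ≤ 0 for all r ∈ rows}`. -/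
theorem tab_inCone {q : ℕ} (hq : 1 ≤ q) {data : List (List (Part × Part))} {rows : List (List ℤ)}
    (hdata : dataValid q data = true) (hrows : ∀ r ∈ rows, ∃ t, rowCheck q rows data r t = true) :
    ∀ t : SumTree, InCone rows (tab q t)
  | .leaf x => by
      have : tab q (.leaf x) = fun _ => 0 := funext fun i => tab_leaf q x i
      rw [this]; exact inCone_zero rows
  | .node a b => by
      have hN := inCone_nodeMap hrows (tab_inCone hq hdata hrows a) (tab_inCone hq hdata hrows b)
      refine ⟨fun i => tab_nonneg q _ i, fun r hr => ?_⟩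
      obtain ⟨t, ht⟩ := hrows r hr
      have hlen : r.length ≤ 2 ^ (q - 1) := by
        simp only [rowCheck, Bool.and_eq_true, decide_eq_true_eq] at ht; exact ht.1
      have e : dot r (tab q (.node a b)) = dot r (nodeMap q data (tab q a) (tab q b)) := by
        refine dot_congr r fun i hi => ?_
        have hi' : i < 2 ^ (q - 1) := lt_of_lt_of_le hi hlen
        have hv : coordValid q (data.getD i []) i = true :=
          List.all_eq_true.1 hdata i (List.mem_range.2 hi')
        exact tab_node hq hi' hv a b
      rw [e]
      exact hN.2 r hr

end Summit.Ventures.CertifiedArithmetic.LowPrec.Opt
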